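import Summits.RiemannHypothesis.RiemannHypothesis.Theorems.MotivicDoorCertPosPolarEncl
import HarnessLib

/-!
# Motivic door / CERTPOS — coupled (full-parity) conditioned classes (`rhdoor.certpos/2`)

pub-rhdoor (MOTIVIC-DOOR ticket), unit `certpos` (gen 2); honest framing as in `MotivicDoorCertPosConstrained`.
The truncated Weil form does not mix parities (`evenBlock ⊕ oddBlock`), but ONE pole condition `ĝ(i/2) = 0` on a
general (non-parity) test function does: in the dictionary of `MotivicDoorCertPosConstrained` it reads
`polarGen ⬝ᵥ v = oddPolarGen ⬝ᵥ u`, i.e. `d ⬝ᵥ (v,u) = 0` with `d = (polarGen, −oddPolarGen)`. This file provides the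
block-diagonal ambient matrix `coupled E O` on `Fin (m+n)`, the splitting of its quadratic form
(`append_form_coupled`), the conditioned lower bound `coupled_form_ge_margin` and negative witness
`coupled_exists_classNeg` (from the generic penalty / `ClassWitness` devices), and the PROVED enclosure of the coupled
constraint vector (`enclosesVec_coupledTail` = CC class with centre condition, `enclosesVec_coupledFull` = one pole
condition only). RH-free, `ζ`-free, no axioms.
-/

open Finset Matrix Real
open scoped BigOperators

set_option linter.dupNamespace false  -- the mandated namespace repeats `RiemannHypothesis`

namespace Summit.RiemannHypothesis.RiemannHypothesis.Theorems.MotivicDoor.CertPos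

open Summit.RiemannHypothesis.RiemannHypothesis.Theorems.PfPersistence
open Summit.RiemannHypothesis.RiemannHypothesis.Theorems.PfPersistence.PolarRankOne

/-- The block-diagonal ambient matrix of a full-parity class: an even-type block on `Fin m` and an odd block on `Fin n`,
indexed by `Fin (m + n)` (even indices first). [folklore] -/
def coupled {m n : ℕ} (E : Matrix (Fin m) (Fin m) ℝ) (O : Matrix (Fin n) (Fin n) ℝ) :
    Matrix (Fin (m + n)) (Fin (m + n)) ℝ :=
  Matrix.reindex finSumFinEquiv finSumFinEquiv (Matrix.fromBlocks E 0 0 O)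

section coupled
variable {m n : ℕ} (E : Matrix (Fin m) (Fin m) ℝ) (O : Matrix (Fin n) (Fin n) ℝ)

/-- even–even entry of `coupled`. [folklore] -/
@[simp] theorem coupled_ll (i j : Fin m) : coupled E O (Fin.castAdd n i) (Fin.castAdd n j) = E i j := by
  simp [coupled, Matrix.reindex_apply, Matrix.submatrix_apply]
/-- even–odd entry of `coupled` vanishes. [folklore] -/
@[simp] theorem coupled_lr (i : Fin m) (j : Fin n) : coupled E O (Fin.castAdd n i) (Fin.natAdd m j) = 0 := by
  simp [coupled, Matrix.reindex_apply, Matrix.submatrix_apply]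
/-- odd–even entry of `coupled` vanishes. [folklore] -/
@[simp] theorem coupled_rl (i : Fin n) (j : Fin m) : coupled E O (Fin.natAdd m i) (Fin.castAdd n j) = 0 := by
  simp [coupled, Matrix.reindex_apply, Matrix.submatrix_apply]
/-- odd–odd entry of `coupled`. [folklore] -/
@[simp] theorem coupled_rr (i j : Fin n) : coupled E O (Fin.natAdd m i) (Fin.natAdd m j) = O i j := by
  simp [coupled, Matrix.reindex_apply, Matrix.submatrix_apply]

/-- PROVED: `(x,y) ⬝ᵥ (p,q) = x ⬝ᵥ p + y ⬝ᵥ q`. [folklore] -/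
theorem append_dotProduct_append (x p : Fin m → ℝ) (y q : Fin n → ℝ) :
    Fin.append x y ⬝ᵥ Fin.append p q = x ⬝ᵥ p + y ⬝ᵥ q := by
  simp only [dotProduct, Fin.sum_univ_add, Fin.append_left, Fin.append_right]

/-- PROVED: the block-diagonal form splits: `(x,y)ᵀ coupled(E,O) (x,y) = xᵀEx + yᵀOy`. [folklore] -/
theorem append_form_coupled (x : Fin m → ℝ) (y : Fin n → ℝ) :
    Fin.append x y ⬝ᵥ (coupled E O *ᵥ Fin.append x y) = x ⬝ᵥ (E *ᵥ x) + y ⬝ᵥ (O *ᵥ y) := by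
  simp only [dotProduct, Matrix.mulVec, Fin.sum_univ_add, Fin.append_left, Fin.append_right, coupled_ll, coupled_lr,
    coupled_rl, coupled_rr, zero_mul, Finset.sum_const_zero, add_zero, zero_add]

end coupled

/-- **PROVED — COUPLED CONDITIONED LOWER BOUND.** A valid certificate enclosing
`coupled E O + s • d dᵀ` with `d = (g, −h)` gives `margin · (xᵀx + yᵀy) ≤ xᵀEx + yᵀOy` whenever `g ⬝ᵥ x = h ⬝ᵥ y`
(one pole condition `ĝ(1) = 0` coupling the parities). [folklore] -/
theorem coupled_form_ge_margin (c : GramCert) (hv : c.Valid) {m n : ℕ} (hk : c.k = m + n)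
    (E : Matrix (Fin m) (Fin m) ℝ) (O : Matrix (Fin n) (Fin n) ℝ) (s : ℝ) (g : Fin m → ℝ) (h : Fin n → ℝ)
    (hP : c.Encloses (coupled E O + s • Matrix.vecMulVec (Fin.append g (-h)) (Fin.append g (-h))))
    (x : Fin m → ℝ) (y : Fin n → ℝ) (hxy : g ⬝ᵥ x = h ⬝ᵥ y) :
    (c.margin : ℝ) * (x ⬝ᵥ x + y ⬝ᵥ y) ≤ x ⬝ᵥ (E *ᵥ x) + y ⬝ᵥ (O *ᵥ y) := by
  have horth : Fin.append g (-h) ⬝ᵥ Fin.append x y = 0 := by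
    rw [append_dotProduct_append, neg_dotProduct, hxy]; ring
  have h1 := form_ge_margin_of_orth c hv hk _ s _ hP (Fin.append x y) horth
  rwa [append_form_coupled, append_dotProduct_append] at h1

/-- **PROVED — COUPLED NEGATIVE CELL (abstract form).** [folklore] -/
theorem coupled_exists_classNeg (c : GramCert) {m n : ℕ} (hk : c.k = m + n)
    (E : Matrix (Fin m) (Fin m) ℝ) (O : Matrix (Fin n) (Fin n) ℝ) (s : ℝ) (g : Fin m → ℝ) (h : Fin n → ℝ)
    (hP : c.Encloses (coupled E O + s • Matrix.vecMulVec (Fin.append g (-h)) (Fin.append g (-h))))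
    (z : ClassWitness) (hd : z.EnclosesVec (Fin.append g (-h))) (hz : c.classNegOK z = true) :
    ∃ (x : Fin m → ℝ) (y : Fin n → ℝ), g ⬝ᵥ x = h ⬝ᵥ y ∧ x ⬝ᵥ (E *ᵥ x) + y ⬝ᵥ (O *ᵥ y) < 0 := by
  obtain ⟨v, hdv, _, hneg⟩ := exists_classNeg c hk _ s _ hP z hd hz
  refine ⟨fun i => v (Fin.castAdd n i), fun j => v (Fin.natAdd m j), ?_, ?_⟩
  · have e : v = Fin.append (fun i => v (Fin.castAdd n i)) (fun j => v (Fin.natAdd m j)) :=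
      (Fin.append_castAdd_natAdd (f := v)).symm
    rw [e, append_dotProduct_append, neg_dotProduct] at hdv
    linarith
  · have e : v = Fin.append (fun i => v (Fin.castAdd n i)) (fun j => v (Fin.natAdd m j)) :=
      (Fin.append_castAdd_natAdd (f := v)).symm
    rw [e, append_form_coupled] at hneg
    exact hneg

namespace ClassWitness

/-- **PROVED — the CC-class constraint vector** `(polarGen (2a) (i+1))_{i<N} ⧺ (−oddPolarGen (2a) (j+1))_{j<N}` is
enclosed by `z` whenever `evenEnclOK a 1 N 0` and `oddEnclOK a N N true` pass. [folklore] -/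
theorem enclosesVec_coupledTail (z : ClassWitness) (a : ℚ) (ha : 0 < a) (N M : ℕ)
    (h1 : z.evenEnclOK a 1 N 0 = true) (h2 : z.oddEnclOK a M N true = true) :
    z.EnclosesVec (Fin.append (fun i : Fin N => polarGen (2 * (a : ℝ)) ((i : ℕ) + 1))
      (-(fun j : Fin M => oddPolarGen (2 * (a : ℝ)) ((j : ℕ) + 1)))) := by
  intro I
  induction I using Fin.addCases with
  | left i =>
    have := z.encl_of_evenEnclOK a ha 1 N 0 one_ne_zero h1 i i.isLt
    simpa [Fin.append_left, Nat.add_comm] using this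
  | right j =>
    have := z.encl_of_oddEnclOK a ha M N true h2 j j.isLt
    simpa [Fin.append_right, sgnOdd] using this

/-- **PROVED — the one-pole (no centre) constraint vector** `(polarGen (2a) n)_{n ≤ N} ⧺ (−oddPolarGen (2a) (j+1))_{j<M}`. [folklore] -/
theorem enclosesVec_coupledFull (z : ClassWitness) (a : ℚ) (ha : 0 < a) (N M : ℕ)
    (h0 : z.evenHeadEnclOK 0 = true) (h1 : z.evenEnclOK a 1 N 1 = true)
    (h2 : z.oddEnclOK a M (N + 1) true = true) :
    z.EnclosesVec (Fin.append (fun n : Fin (N + 1) => polarGen (2 * (a : ℝ)) n)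
      (-(fun j : Fin M => oddPolarGen (2 * (a : ℝ)) ((j : ℕ) + 1)))) := by
  intro I
  induction I using Fin.addCases with
  | left i =>
    have := z.enclosesVec_evenFull a ha N h0 h1 i
    simpa [Fin.append_left] using this
  | right j =>
    have := z.encl_of_oddEnclOK a ha M (N + 1) true h2 j j.isLt
    simpa [Fin.append_right, sgnOdd] using this

end ClassWitness

end Summit.RiemannHypothesis.RiemannHypothesis.Theorems.MotivicDoor.CertPos
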